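import Summits.QuantumFields.YangMills.Theorems.BalabanUVNodesN12ForestPreimageL1Letter
import Summits.QuantumFields.YangMills.Theorems.BalabanUVNodesN12HVelocityOfClass
import Summits.QuantumFields.YangMills.Theorems.BalabanUVNodesN12MultiplierLetterOfSlicePreimage
import Summits.QuantumFields.YangMills.Theorems.BalabanUVNodesN12TowerGuardsOfClass
import Summits.QuantumFields.YangMills.Theorems.BalabanUVNodesN12RightInverseLevelZeroLocality
import Literature.MathematicalPhysics.QuantumFieldTheory.Balaban1983to89.B15Prop1LinearisedKernelLevelZero
import HarnessLib

/-!
# BalabanUVNodes ∕ N12 — THE (45) SLICE RIGHT INVERSE WITH `Γ₀`-SUPPORT AND `ℓ¹` LETTER IN THE (J0′) PRODUCER's CURRENCY (`DΦ₀(0)` of the slice datum coordinates) FOR EVERY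
# (2.12)-CLASS MINIMISER — the letter (R1a) of the multiplier row (M) (p710811 `multiplierLetter_of_rightInverseOn`) DISCHARGED on the level-`0`-free data; hence (M) per base field
# modulo the level-`0`-freeness of the curvature data (R1b) and the curvature letter (R2)
# ([Balaban1985Variational] (3)–(4) p. 278, Sect. C (44)–(48) p. 285, (82)–(83) p. 290; [Balaban1988Convergent] (2.2) p. 255, (2.10)–(2.13) pp. 256–257; [Balaban1989LargeFieldII] (1.12) p. 359)

Cell `pub-ymgap` (HUMAN RULINGS D-0062 ∕ D-0149), WIDTH SEAT `pub-ymgap-dag-n12-w6` g14 (node N12 = [B15]; key K1⁹ `stmt-QuantumFields-27364`, `--kind proof --supports … --as helper`;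
count-neutral; bus 2026-08-29 DAGN12W6-G14 CLAIM-2, file C).  THEOREMS ONLY (0 `def`, 0 `instance`, 0 `sorry`).  CONSUMED BY NAME, nothing modified: file B
`N12ForestPreimageL1Letter.exists_forest_preimage_l1_support_Bj_of_isMinimizer_class`, g11's velocity lemmas `N12HVelocityOfClass.hasDerivAt_coe_avgFamily_expChart_smul_of_sharpProxy` ∕
`…_levelZero` (p708777) and their dictionary (`exists_realCoords_of_lieSUField`, `cplxVec_mem_of_forall_path`, `eq_of_sum_smul_genE_eq`, `expMul_su2Chart_smul_eq_expChart`), the lane owner's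
`B15Prop1LinearisedKernelLevelZero.fderiv_sliceDatum_cplxVec_apply_eq_of_hasDerivAt_of_guardOn` (p710613) + `logCoordCLM_genE_sum`, `…N12TowerGuardsOfClass.guardOn_towerRegion_Bj_of_mem_class`,
`…N12RightInverseLevelZeroLocality.mem_bondsOf_Bj_zero`, p710811 `multiplierLetter_of_rightInverseOn`.  WHY ∕ HOW: file B's slice preimage in chart currency (`ℓ¹(op)` letter, `Γ₀`-support)
is moved to the LEFT-FIELD velocity currency (`p̂ := Ad(U₀)X`, an isometry bondwise, `exp(s p̂)·U₀ = U₀·exp(sX)`, velocities row by row through sharp proxies) and then to `DΦ₀(0)` by the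
lane's tower lemma (`DΦ₀(0)ŷ_i = T(W_i⋆·v_i)`, `T(W⋆W·Σ τ_a E_a) = τ`); a complex datum is split into real and imaginary parts.

CONTENTS.  §1 ★★ `velocity_of_slicePreimage`; §2 ★ `fderiv_sliceDatum_cplxVec_eq_coords_of_velocity`; §3 coordinate bookkeeping + ★★★ `sliceRightInverseOn_levelZeroFree_Bj_of_isMinimizer_class`
((R1a) at the record, `B₁ := √2·(1 + 2·#bonds·Lp)·√#bonds·B`, per-height letters only); §4 ★★★ `multiplierLetter_Bj_of_isMinimizer_class` ((M) per base field from §3 + p710811, modulo the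
DISPLAYED (R1b), (R2); `m := 8(d−1)·δ·B₁·M₂`).

HONEST FRAMING.  Bookkeeping by name; per-height (volume-dependent) EXISTENCE letters — print's volume-uniform (46) NOT claimed; (R1b), (R2), (P) stay DISPLAYED ∕ untouched; nothing of
Bałaban's asserted; N12 NOT discharged; K1⁹ NOT closed; counts of record unmoved (typed 28∕28 · discharged 8∕27); one finite 𝕋⁴ programme at fixed ε — R4 closes the conditional rung
`BalabanLadder.UV` only; no summit statement is proved here and NOT the Yang–Mills mass gap (Clay); nothing continuum ∕ ℝ⁴ ∕ OS.
-/

noncomputable section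

namespace Summit.QuantumFields.YangMills.BalabanUVNodes.N12SlicePreimageLetterOfClass

open scoped BigOperators Matrix.Norms.L2Operator Topology
open Literature.MathematicalPhysics.QuantumFieldTheory.Balaban1983to89
open Literature.MathematicalPhysics.QuantumLattice (quatMatrix)
open T4Continuum
open B15DeterminingSets GaugeField
open BlockAveraging (blockAvg)
open ExpMeanLog (expMeanLogSU)
open T4HaarSU2ExpChart (imQuat)
open T4AdjointCovarianceUnitary (lieSU specialUnitaryAd coe_specialUnitaryAd specialUnitaryAd_inv_apply)
open Node00
open B15SU2ChartHolomorphic (genE expMulC logCoordC quatMatrix_imQuat)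
open B15AveragingHolomorphic (iterMh)
open B15Prop1AnalyticExtClause (cplxVec)
open B15Prop1ChartCalculusSU2 (E3)
open B15Prop1ChartSU2 (su2Chart)
open T4CubeChartGnomonic (SU2)
open B5Eq118OneStroke (iterBlockOf)
open B14.Eq213DetSet (Bj maxDomT)
open B14.Eq213MaximalDomains (side)
open B14.Eq216Concrete (feeds)
open B15Eq112TorusCover (lift)
open T4AxialGaugeSmallField (boxPlaqs)
open B16Sect1Backgrounds (expMul)
open B16Ineq19FlatSliceChart (exists_lieSU2Coord norm_sq_lieSU2Coord)
open B16Ineq19NearFlatSlice (norm_coe_lieSU2Coord)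
open B15Prop1LinearisedDatumCoordinates (exists_logCoordCLM)
open B15Prop1OntoFromRightInverse (logCoordCLM_genE_sum)
open B15Prop1LinearisedKernelLevelZero (fderiv_sliceDatum_cplxVec_apply_eq_of_hasDerivAt_of_guardOn)
open Literature.MathematicalPhysics.QuantumFieldTheory.Balaban1983to89.B15Prop1RightInverseFromForestLeftField (exists_realCoords_of_lieSUField cplxVec_mem_of_forall_path eq_of_sum_smul_genE_eq)
open Summit.QuantumFields.YangMills.BalabanUVNodes.N12HVelocityOfClass (hasDerivAt_coe_avgFamily_expChart_smul_of_sharpProxy hasDerivAt_coe_avgFamily_expChart_smul_levelZero)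
open Summit.QuantumFields.YangMills.BalabanUVNodes.N12DirectSurjHsurjProxiesPrelim (differentiableAt_msChart_of_towerProxies)
open Summit.QuantumFields.YangMills.BalabanUVNodes.N12DirectSurjHsurjPrelim (inner_endpoint_of_mem_bondsOf_Bj)
open Summit.QuantumFields.YangMills.BalabanUVNodes.N12ForestPreimageL1Letter (exists_forest_preimage_l1_support_Bj_of_isMinimizer_class)
open Summit.QuantumFields.YangMills.BalabanUVNodes.N12TowerProxiesOfClass (towerProxies_Bj_of_mem_class)
open Summit.QuantumFields.YangMills.BalabanUVNodes.N12SiteProxiesOfClass (siteProxies_Bj_of_mem_class)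
open Summit.QuantumFields.YangMills.BalabanUVNodes.N12TowerGuardsOfClass (guardOn_towerRegion_Bj_of_mem_class)
open Summit.QuantumFields.YangMills.BalabanUVNodes.N12RightInverseLevelZeroLocality (mem_bondsOf_Bj_zero)
open Summit.QuantumFields.YangMills.BalabanUVNodes.N12MultiplierLetterOfSlicePreimage (multiplierLetter_of_rightInverseOn)

variable {F : T4Family} {K k : ℕ}

/-! ## §1  From a slice-valued chart-currency preimage to a real slice field with the velocities -/

section Velocity

/-- ★★ **A SLICE-VALUED CHART-CURRENCY PREIMAGE YIELDS A REAL SLICE FIELD WITH THE VELOCITIES** (g11's (45) dictionary for a GIVEN field `X` vanishing on the path bonds with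
`DΨ(0)X = φ ∘ τ`): the real coordinates `p` of `p̂ := Ad(U₀)X` have `cplxVec p ∈ S`, `‖p b‖ = ‖↑X_b‖_op`, `p b = 0` where `X b = 0`, and every constrained average of
`exp(s p̂)·U₀ = U₀·exp(sX)` has velocity `↑W_i·(Σ_a τ_{i,a} E_a)` at `s = 0` (level `0` on the bond, positive levels at a sharp proxy).
[cite: Balaban1985Variational, (3)–(4) p.278, Sect. C (44)–(48) p.285, (82)–(83) p.290; Balaban1989LargeFieldII, (1.19) p.360; Balaban1988Convergent, (2.10)–(2.11) p.256] -/
theorem velocity_of_slicePreimage (𝔹 : DetSet (F.P K)) (hk : k ≤ (F.P K).m + (F.P K).K)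
    {W : MSField (F.P K) SU2} {U₀ : GaugeField (F.P K) 0 SU2} (hU : AgreeOn 𝔹 (avgFamily (avOfRecord F 2 K) U₀) W)
    (hΨ : DifferentiableAt ℝ (msChart F 2 K k 𝔹 W U₀) 0)
    (hsharp : ∀ i : Fin (constrCard 𝔹 k), 1 ≤ (((constrEnum 𝔹 k).symm i).1 : ℕ) → ∃ U' : GaugeField (F.P K) 0 SU2,
      SmallBelow (avOfRecord F 2 K) k U' ∧ ∀ b₀ : PBond (F.P K) 0,
        (iterBlockOf (((constrEnum 𝔹 k).symm i).1 : ℕ) b₀.src = ((constrEnum 𝔹 k).symm i).2.1.src ∨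
          iterBlockOf (((constrEnum 𝔹 k).symm i).1 : ℕ) b₀.src = ((constrEnum 𝔹 k).symm i).2.1.tgt) →
        (iterBlockOf (((constrEnum 𝔹 k).symm i).1 : ℕ) b₀.tgt = ((constrEnum 𝔹 k).symm i).2.1.src ∨
          iterBlockOf (((constrEnum 𝔹 k).symm i).1 : ℕ) b₀.tgt = ((constrEnum 𝔹 k).symm i).2.1.tgt) → U' b₀ = U₀ b₀)
    (S : Submodule ℂ (VecField (F.P K) 0 (EuclideanSpace ℂ (Fin 3)))) {path : Site (F.P K) 0 → List (LStep (F.P K) 0)}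
    (hF3 : ∀ Y : VecField (F.P K) 0 (EuclideanSpace ℂ (Fin 3)), Y ∈ S ↔ ∀ x, ∀ s ∈ path x, Y s.bond = 0)
    {φ : EuclideanSpace ℝ (Fin 3) →ₗ[ℝ] lieSU (Fin 2)} (hφ : ∀ v, ((φ v : lieSU (Fin 2)) : Matrix (Fin 2) (Fin 2) ℂ) = quatMatrix (imQuat v))
    (X : PBond (F.P K) 0 → lieSU (Fin 2)) (hXS : ∀ x, ∀ s ∈ path x, X s.bond = 0)
    (τ : Fin (constrCard 𝔹 k) → EuclideanSpace ℝ (Fin 3)) (hXτ : fderiv ℝ (msChart F 2 K k 𝔹 W U₀) 0 X = fun i => φ (τ i)) :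
    ∃ p : VecField (F.P K) 0 E3, cplxVec p ∈ S ∧ (∀ b, ‖p b‖ = ‖(X b : Matrix (Fin 2) (Fin 2) ℂ)‖) ∧ (∀ b, X b = 0 → p b = 0) ∧
      ∀ i : Fin (constrCard 𝔹 k), HasDerivAt (fun s : ℝ => ((avgFamily (avOfRecord F 2 K) (expMul su2Chart (s • p) U₀)
        ((constrEnum 𝔹 k).symm i).1 ((constrEnum 𝔹 k).symm i).2.1 : SU2) : Matrix (Fin 2) (Fin 2) ℂ))
        (((W ((constrEnum 𝔹 k).symm i).1 ((constrEnum 𝔹 k).symm i).2.1 : SU2) : Matrix (Fin 2) (Fin 2) ℂ) * ∑ b : Fin 3, ((τ i b : ℝ) : ℂ) • genE b) 0 := by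
  obtain ⟨p, hp⟩ := exists_realCoords_of_lieSUField (fun b => specialUnitaryAd (U₀ b) (X b))
  have hpzero : ∀ b, X b = 0 → p b = 0 := fun b hXb => by
    have h := hp b
    rw [hXb, map_zero, Submodule.coe_zero] at h
    have h0 : (∑ a : Fin 3, (((0 : EuclideanSpace ℝ (Fin 3)) a : ℝ) : ℂ) • genE a) = 0 := by simp
    exact eq_of_sum_smul_genE_eq (h.trans h0.symm)
  have hp0 : ∀ x, ∀ s ∈ path x, p s.bond = 0 := fun x s hs => hpzero _ (hXS x s hs)
  have hφp : ∀ b, φ (p b) = specialUnitaryAd (U₀ b) (X b) := fun b => Subtype.ext (by rw [hφ, quatMatrix_imQuat]; exact hp b)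
  have hnorm : ∀ b, ‖p b‖ = ‖(X b : Matrix (Fin 2) (Fin 2) ℂ)‖ := fun b => by
    rw [← norm_coe_lieSU2Coord hφ (p b), hφp b, norm_coe_specialUnitaryAd]
  refine ⟨p, cplxVec_mem_of_forall_path S path hF3 hp0, hnorm, hpzero, fun i => ?_⟩
  have hF : (fun b => specialUnitaryAd (U₀ b)⁻¹ (φ (p b))) = X := funext fun b => by rw [hφp b, specialUnitaryAd_inv_apply]
  have hfun : (fun s : ℝ => ((avgFamily (avOfRecord F 2 K) (expMul su2Chart (s • p) U₀)
        ((constrEnum 𝔹 k).symm i).1 ((constrEnum 𝔹 k).symm i).2.1 : SU2) : Matrix (Fin 2) (Fin 2) ℂ)) =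
      fun s : ℝ => ((avgFamily (avOfRecord F 2 K) (expChart U₀ (s • X))
        ((constrEnum 𝔹 k).symm i).1 ((constrEnum 𝔹 k).symm i).2.1 : SU2) : Matrix (Fin 2) (Fin 2) ℂ) := by
    funext s; rw [expMul_su2Chart_smul_eq_expChart hφ p U₀ s, hF]
  have hτi : ((φ (τ i) : lieSU (Fin 2)) : Matrix (Fin 2) (Fin 2) ℂ) = ∑ b : Fin 3, ((τ i b : ℝ) : ℂ) • genE b := by
    rw [hφ, quatMatrix_imQuat]
  have hyi : fderiv ℝ (msChart F 2 K k 𝔹 W U₀) 0 X i = φ (τ i) := by rw [hXτ]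
  rw [hfun, ← hτi]
  rcases Nat.eq_zero_or_pos (((constrEnum 𝔹 k).symm i).1 : ℕ) with h0 | hpos
  · -- a `Γ₀` row: read the bond itself
    generalize hy' : φ (τ i) = y at hyi ⊢
    rw [← (constrEnum 𝔹 k).apply_symm_apply i] at hyi
    generalize hr : (constrEnum 𝔹 k).symm i = r at hyi h0 ⊢
    obtain ⟨⟨j, hj⟩, c, hc⟩ := r
    obtain rfl : j = 0 := h0
    exact hasDerivAt_coe_avgFamily_expChart_smul_levelZero hU hΨ c hc X hyi
  · obtain ⟨U', hsb', hin⟩ := hsharp i hpos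
    exact hasDerivAt_coe_avgFamily_expChart_smul_of_sharpProxy hk hU hΨ hsb' i hin X hyi

end Velocity

/-! ## §2  From the velocities to `DΦ₀(0)` on the slice -/

section Datum

variable {P : Params}

/-- ★ **VELOCITIES `↑W_i·(Σ_a τ_{i,a} E_a)` ⟹ `DΦ₀(0)⟨cplxVec p⟩ = ι τ`** (per-tower guards, fibre, `Φ₀` by its formula): the lane's `DΦ₀(0)ŷ_i = T(W_i⋆·v_i)`, `W_i⋆W_i = 1`, `T(Σ_a τ_a E_a) = τ`.
[cite: Balaban1985Variational, Sect. C (45)–(48) p.285, (82)–(83) p.290; Balaban1988Convergent, (2.10)–(2.11) p.256; Balaban1985Averaging, (21) p.21] -/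
theorem fderiv_sliceDatum_cplxVec_eq_coords_of_velocity (𝔹 : DetSet P) (k : ℕ) (hk : k ≤ P.m + P.K) (W : MSField P SU2) {U₀ : GaugeField P 0 SU2}
    (hgU : ∀ i : Fin (constrCard 𝔹 k), ∀ j', j' < (((constrEnum 𝔹 k).symm i).1 : ℕ) → ∀ c' : PBond P (j' + 1),
      c' ∈ B10Eq42TorusConstraint.bondsIn (j' + 1) (B14.Eq22Determines.blockIter (((constrEnum 𝔹 k).symm i).1 : ℕ) ⁻¹'
        ({((constrEnum 𝔹 k).symm i).2.1.src, ((constrEnum 𝔹 k).symm i).2.1.tgt} : Set (Site P ((constrEnum 𝔹 k).symm i).1))) →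
        BlockAveraging.Small expMeanLogSU (Averaging.iter (fun j => blockAvg (P := P) (j := j) expMeanLogSU) j' U₀) c')
    (hU₀ : AgreeOn 𝔹 (avgFamily (fun j => blockAvg (P := P) (j := j) expMeanLogSU) U₀) W)
    (S : Submodule ℂ (VecField P 0 (EuclideanSpace ℂ (Fin 3))))
    {Φ₀ : S → Fin (constrCard 𝔹 k) → EuclideanSpace ℂ (Fin 3)}
    (hΦ₀ : ∀ (X : S) i, Φ₀ X i = logCoordC (star ((W ((constrEnum 𝔹 k).symm i).1 ((constrEnum 𝔹 k).symm i).2.1 : SU2) : Matrix (Fin 2) (Fin 2) ℂ) *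
      iterMh ((constrEnum 𝔹 k).symm i).1 (expMulC (X : VecField P 0 (EuclideanSpace ℂ (Fin 3))) (coeField U₀)) ((constrEnum 𝔹 k).symm i).2.1))
    {p : VecField P 0 E3} (hp : cplxVec p ∈ S) (τ : Fin (constrCard 𝔹 k) → EuclideanSpace ℝ (Fin 3))
    (hv : ∀ i : Fin (constrCard 𝔹 k), HasDerivAt (fun s : ℝ => ((avgFamily (fun j => blockAvg (P := P) (j := j) expMeanLogSU) (expMul su2Chart (s • p) U₀)
      ((constrEnum 𝔹 k).symm i).1 ((constrEnum 𝔹 k).symm i).2.1 : SU2) : Matrix (Fin 2) (Fin 2) ℂ))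
      (((W ((constrEnum 𝔹 k).symm i).1 ((constrEnum 𝔹 k).symm i).2.1 : SU2) : Matrix (Fin 2) (Fin 2) ℂ) * ∑ b : Fin 3, ((τ i b : ℝ) : ℂ) • genE b) 0) :
    fderiv ℂ Φ₀ 0 ⟨cplxVec p, hp⟩ = fun i => WithLp.toLp 2 fun a => ((τ i a : ℝ) : ℂ) := by
  obtain ⟨T, hT⟩ := exists_logCoordCLM
  funext i; rw [fderiv_sliceDatum_cplxVec_apply_eq_of_hasDerivAt_of_guardOn 𝔹 k hk W hgU hU₀ S hΦ₀ hT hp i (hv i), ← mul_assoc,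
    Unitary.star_mul_self_of_mem (Matrix.specialUnitaryGroup_le_unitaryGroup (W ((constrEnum 𝔹 k).symm i).1 ((constrEnum 𝔹 k).symm i).2.1).2), one_mul]
  have e : (∑ b : Fin 3, ((τ i b : ℝ) : ℂ) • genE b) = ∑ b : Fin 3, (WithLp.toLp 2 (fun a => ((τ i a : ℝ) : ℂ)) : EuclideanSpace ℂ (Fin 3)) b • genE b :=
    Finset.sum_congr rfl fun b _ => rfl
  rw [e]
  exact logCoordCLM_genE_sum hT _

end Datum

/-! ## §3  Coordinate bookkeeping and (R1a) at the record -/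

section Record

/-- The real-part vector of a complex coordinate vector is not longer: `‖(Re u_a)_a‖ ≤ ‖u‖` in `ℝ³` ∕ `ℂ³`. [folklore] -/
theorem norm_reCoords_le (w : EuclideanSpace ℂ (Fin 3)) : ‖(WithLp.toLp 2 fun a => (w a).re : EuclideanSpace ℝ (Fin 3))‖ ≤ ‖w‖ := by
  rw [EuclideanSpace.norm_eq, EuclideanSpace.norm_eq]
  refine Real.sqrt_le_sqrt (Finset.sum_le_sum fun a _ => ?_)
  have h : |(w a).re| ≤ ‖w a‖ := Complex.abs_re_le_norm (w a)
  have h' : ‖(WithLp.toLp 2 (fun a => (w a).re) : EuclideanSpace ℝ (Fin 3)) a‖ = |(w a).re| := rfl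
  rw [h']
  exact pow_le_pow_left₀ (abs_nonneg _) h 2

/-- The imaginary-part vector of a complex coordinate vector is not longer: `‖(Im u_a)_a‖ ≤ ‖u‖`. [folklore] -/
theorem norm_imCoords_le (w : EuclideanSpace ℂ (Fin 3)) : ‖(WithLp.toLp 2 fun a => (w a).im : EuclideanSpace ℝ (Fin 3))‖ ≤ ‖w‖ := by
  rw [EuclideanSpace.norm_eq, EuclideanSpace.norm_eq]
  refine Real.sqrt_le_sqrt (Finset.sum_le_sum fun a _ => ?_)
  have h : |(w a).im| ≤ ‖w a‖ := Complex.abs_im_le_norm (w a)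
  have h' : ‖(WithLp.toLp 2 (fun a => (w a).im) : EuclideanSpace ℝ (Fin 3)) a‖ = |(w a).im| := rfl
  rw [h']
  exact pow_le_pow_left₀ (abs_nonneg _) h 2

/-- The `ℝ³ ≅ 𝔰𝔲(2)` coordinate scales the Hilbert–Schmidt norm by `√2`: `‖φ v‖ = √2·‖v‖` (dag-n12-w3's `norm_sq_lieSU2Coord`). [cite: Balaban1985Averaging, (17) p.21; Balaban1989LargeFieldII, (1.19) p.360] -/
theorem norm_lieSU2Coord_eq {φ : EuclideanSpace ℝ (Fin 3) →ₗ[ℝ] lieSU (Fin 2)} (hφ : ∀ v, ((φ v : lieSU (Fin 2)) : Matrix (Fin 2) (Fin 2) ℂ) = quatMatrix (imQuat v))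
    (v : EuclideanSpace ℝ (Fin 3)) : ‖φ v‖ = Real.sqrt 2 * ‖v‖ := by
  rw [← Real.sqrt_sq (norm_nonneg (φ v)), norm_sq_lieSU2Coord hφ v, Real.sqrt_mul (by norm_num), Real.sqrt_sq (norm_nonneg v)]

/-- `u = ι(Re u) + I•ι(Im u)` coordinatewise. [folklore] -/
theorem reCoords_add_I_smul_imCoords {n : ℕ} (u : Fin n → EuclideanSpace ℂ (Fin 3)) :
    ((fun i => (WithLp.toLp 2 fun a => (((WithLp.toLp 2 fun a => (u i a).re : EuclideanSpace ℝ (Fin 3)) a : ℝ) : ℂ) : EuclideanSpace ℂ (Fin 3))) +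
      Complex.I • (fun i => (WithLp.toLp 2 fun a => (((WithLp.toLp 2 fun a => (u i a).im : EuclideanSpace ℝ (Fin 3)) a : ℝ) : ℂ) : EuclideanSpace ℂ (Fin 3)))) = u := by
  funext i
  ext a
  show ((u i a).re : ℂ) + Complex.I * ((u i a).im : ℂ) = u i a
  rw [mul_comm]
  exact Complex.re_add_im (u i a)

/-- ★★★ **(R1a) AT THE RECORD FOR EVERY (2.12)-CLASS MINIMISER** — the letter `hRI` of p710811's `multiplierLetter_of_rightInverseOn` on `Adm := {u | u = 0 at the level-0 rows}`,
`B₀ := {b | b.src ∈ Ω₁(Z)}`, `B₁ := √2·(1 + 2·#bonds·Lp)·√#bonds·B`: per base field (minimiser `U₀` — class membership + fibre —, forest rows (F1)∕roots∕(F3) + `hlen`, `Φ₀` by its formula),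
once per height (`hHB`'s ∀-body, `hsbU`, floors, numerics), every such `u` has real slice fields `y₁ y₂` with `DΦ₀(0)ŷ₁ + I•DΦ₀(0)ŷ₂ = u`, `y₁ = 0` off `Ω₁(Z)`'s sources, `Σ_b‖y₁ b‖ ≤ B₁‖u‖`.
[cite: Balaban1985Variational, (3)–(4) p.278, Sect. C (44)–(48) p.285, (82)–(83) p.290; Balaban1988Convergent, (2.2) p.255, (2.10)–(2.13) pp.256–257; Balaban1989LargeFieldII, (1.12) p.359, (1.19) p.360] -/
theorem sliceRightInverseOn_levelZeroFree_Bj_of_isMinimizer_class (ν : Node00.Stage7Numerics) (Kt : ℕ) (Z : Set (Site (F.P Kt) 0)) (hk0 : 0 < k)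
    (hkK : k + 1 ≤ (F.P Kt).m + (F.P Kt).K) (hM4 : 4 * (F.P Kt).L ≤ ν.M₁) (hdiv : side (F.P Kt).L ν.M₁ k ∣ (F.P Kt).sitesPerDir 0) (hε : 0 ≤ ν.εreg)
    {ρ'' : ℝ} (hsbU : ∀ V : GaugeField (F.P Kt) 0 SU2, ‖coeField V - 1‖ ≤ ρ'' → SmallBelow (avOfRecord F 2 Kt) k V)
    (hερ : 6 * ((((F.P Kt).d - 1 : ℕ)) : ℝ) * (F.P Kt).L * ν.εreg ≤ ρ'')
    {εH B : ℝ}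
    (hHB : ∀ (Wd : MSField (F.P Kt) SU2) (U₀ : GaugeField (F.P Kt) 0 SU2),
      AgreeOn (Bj ν.M₁ Z k) (avgFamily (avOfRecord F 2 Kt) U₀) Wd →
      (∀ i' : Fin (constrCard (Bj ν.M₁ Z k) k), ∃ U' : GaugeField (F.P Kt) 0 SU2,
        (∀ b ∈ feeds (((constrEnum (Bj ν.M₁ Z k) k).symm i').1 : ℕ) ((constrEnum (Bj ν.M₁ Z k) k).symm i').2.1, U' b = U₀ b) ∧
          SmallBelow (avOfRecord F 2 Kt) k U') →
      (∀ (j : ℕ), 1 ≤ j → j ≤ k → ∀ y : Site (F.P Kt) j, embIter j y ∈ maxDomT ν.M₁ Z j → ∃ U' : GaugeField (F.P Kt) 0 SU2,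
        (∀ c : PBond (F.P Kt) j, (c.src = y ∨ c.tgt = y) → ∀ b₀ : PBond (F.P Kt) 0,
          (iterBlockOf j b₀.src = c.src ∨ iterBlockOf j b₀.src = c.tgt) → (iterBlockOf j b₀.tgt = c.src ∨ iterBlockOf j b₀.tgt = c.tgt) → U' b₀ = U₀ b₀) ∧
        SmallBelow (avOfRecord F 2 Kt) k U') →
      (∀ (j : ℕ), 1 ≤ j → j ≤ k → ∀ y : Site (F.P Kt) j, embIter j y ∈ maxDomT ν.M₁ Z j →
        PlaqSmallOn (boxPlaqs (fun κ => lift (F.P Kt) (embIter j y) κ - ((((F.P Kt).L ^ j : ℕ) : ℤ) + ((((F.P Kt).L ^ j - 1) / 2 : ℕ) : ℤ)))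
          (fun κ => lift (F.P Kt) (embIter j y) κ + ((((F.P Kt).L ^ j : ℕ) : ℤ) + ((((F.P Kt).L ^ j - 1) / 2 : ℕ) : ℤ))) : Set (Plaq (F.P Kt) 0)) εH U₀) →
      ∃ H : (Fin (constrCard (Bj ν.M₁ Z k) k) → lieSU (Fin 2)) → PBond (F.P Kt) 0 → lieSU (Fin 2),
        (∀ v, fderiv ℝ (msChart F 2 Kt k (Bj ν.M₁ Z k) Wd U₀) 0 (H v) = v) ∧ ∀ v, Real.sqrt (∑ b, ‖H v b‖ ^ 2) ≤ B * ‖v‖)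
    (hεH : ν.εreg ≤ εH) (hB0 : 0 ≤ B)
    -- per base field: the minimiser (class membership), the datum, the forest, the slice datum coordinates
    {𝔹' : DetSet (F.P Kt)} {W' : MSField (F.P Kt) SU2} {U₀ : GaugeField (F.P Kt) 0 SU2}
    (hmin : IsMinimizer (avOfRecord F 2 Kt) (regMSCoPOfRecord F 2 ν Kt k (maxDomT ν.M₁ Z)) 𝔹' W' U₀)
    {W : MSField (F.P Kt) SU2} (hW : AgreeOn (Bj ν.M₁ Z k) (avgFamily (avOfRecord F 2 Kt) U₀) W)
    (S : Submodule ℂ (VecField (F.P Kt) 0 (EuclideanSpace ℂ (Fin 3)))) {path : Site (F.P Kt) 0 → List (LStep (F.P Kt) 0)}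
    (hroot : ∀ r ∈ {z : Site (F.P Kt) 0 | ∃ j, j ≤ k ∧ ∃ c ∈ bondsOf ((Bj ν.M₁ Z k : DetSet (F.P Kt)) j), (z = embIter j c.src ∨ z = embIter j c.tgt)}, path r = [])
    (hF1 : ∀ x, ∀ s ∈ path x, ∃ x' x'' : Site (F.P Kt) 0, path x'' = path x' ++ [s] ∧
      (s.fwd = true → s.bond.src = x' ∧ s.bond.tgt = x'') ∧ (s.fwd = false → s.bond.src = x'' ∧ s.bond.tgt = x'))
    (hF3 : ∀ Y : VecField (F.P Kt) 0 (EuclideanSpace ℂ (Fin 3)), Y ∈ S ↔ ∀ x, ∀ s ∈ path x, Y s.bond = 0)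
    {Lp : ℕ} (hlen : ∀ x, (path x).length ≤ Lp)
    {Φ₀ : S → Fin (constrCard (Bj ν.M₁ Z k) k) → EuclideanSpace ℂ (Fin 3)}
    (hΦ₀ : ∀ (X : S) i, Φ₀ X i = logCoordC (star ((W ((constrEnum (Bj ν.M₁ Z k) k).symm i).1 ((constrEnum (Bj ν.M₁ Z k) k).symm i).2.1 : SU2) : Matrix (Fin 2) (Fin 2) ℂ) *
      iterMh ((constrEnum (Bj ν.M₁ Z k) k).symm i).1 (expMulC (X : VecField (F.P Kt) 0 (EuclideanSpace ℂ (Fin 3))) (coeField U₀)) ((constrEnum (Bj ν.M₁ Z k) k).symm i).2.1)) :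
    ∀ u : Fin (constrCard (Bj ν.M₁ Z k) k) → EuclideanSpace ℂ (Fin 3),
      (∀ (b : PBond (F.P Kt) 0) (hb : b ∈ bondsOf ((Bj ν.M₁ Z k : DetSet (F.P Kt)) 0)), u (constrEnum (Bj ν.M₁ Z k : DetSet (F.P Kt)) k ⟨⟨0, Nat.succ_pos k⟩, b, hb⟩) = 0) →
      ∃ (y₁ y₂ : VecField (F.P Kt) 0 E3) (h₁ : cplxVec y₁ ∈ S) (h₂ : cplxVec y₂ ∈ S),
        fderiv ℂ Φ₀ 0 ⟨cplxVec y₁, h₁⟩ + Complex.I • fderiv ℂ Φ₀ 0 ⟨cplxVec y₂, h₂⟩ = u ∧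
        (∀ b ∉ {b : PBond (F.P Kt) 0 | b.src ∈ maxDomT ν.M₁ Z 1}, y₁ b = 0) ∧
        ∑ b : PBond (F.P Kt) 0, ‖y₁ b‖ ≤
          (Real.sqrt 2 * ((1 + 2 * (Fintype.card (PBond (F.P Kt) 0)) * Lp) * Real.sqrt (Fintype.card (PBond (F.P Kt) 0)) * B)) * ‖u‖ := by
  intro u hu0
  have hk : k ≤ (F.P Kt).m + (F.P Kt).K := by omega
  obtain ⟨φ, hφ⟩ := exists_lieSU2Coord
  have hprox := towerProxies_Bj_of_mem_class ν Kt Z hkK hM4 hdiv hε hsbU hερ hmin.1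
  have hproxSite := siteProxies_Bj_of_mem_class ν Kt Z hkK hM4 hdiv hε hsbU hερ hmin.1
  have hgU := guardOn_towerRegion_Bj_of_mem_class ν Kt Z hkK hM4 hdiv hε hsbU hερ hmin.1
  have hΨ : DifferentiableAt ℝ (msChart F 2 Kt k (Bj ν.M₁ Z k) W U₀) 0 := differentiableAt_msChart_of_towerProxies hk hW hprox
  have hsharp : ∀ i : Fin (constrCard (Bj ν.M₁ Z k : DetSet (F.P Kt)) k), 1 ≤ (((constrEnum (Bj ν.M₁ Z k) k).symm i).1 : ℕ) → ∃ U' : GaugeField (F.P Kt) 0 SU2,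
      SmallBelow (avOfRecord F 2 Kt) k U' ∧ ∀ b₀ : PBond (F.P Kt) 0,
        (iterBlockOf (((constrEnum (Bj ν.M₁ Z k) k).symm i).1 : ℕ) b₀.src = ((constrEnum (Bj ν.M₁ Z k) k).symm i).2.1.src ∨
          iterBlockOf (((constrEnum (Bj ν.M₁ Z k) k).symm i).1 : ℕ) b₀.src = ((constrEnum (Bj ν.M₁ Z k) k).symm i).2.1.tgt) →
        (iterBlockOf (((constrEnum (Bj ν.M₁ Z k) k).symm i).1 : ℕ) b₀.tgt = ((constrEnum (Bj ν.M₁ Z k) k).symm i).2.1.src ∨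
          iterBlockOf (((constrEnum (Bj ν.M₁ Z k) k).symm i).1 : ℕ) b₀.tgt = ((constrEnum (Bj ν.M₁ Z k) k).symm i).2.1.tgt) → U' b₀ = U₀ b₀ := by
    intro i hpos
    have hjk : (((constrEnum (Bj ν.M₁ Z k) k).symm i).1 : ℕ) ≤ k := Nat.le_of_lt_succ ((constrEnum (Bj ν.M₁ Z k) k).symm i).1.isLt
    have hc : ((constrEnum (Bj ν.M₁ Z k) k).symm i).2.1 ∈ bondsOf ((Bj ν.M₁ Z k : DetSet (F.P Kt)) ((constrEnum (Bj ν.M₁ Z k) k).symm i).1) :=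
      ((constrEnum (Bj ν.M₁ Z k) k).symm i).2.2
    rcases inner_endpoint_of_mem_bondsOf_Bj hpos hjk hc with hy | hy
    · obtain ⟨U', hag, hsb'⟩ := hproxSite _ hpos hjk _ hy
      exact ⟨U', hsb', hag _ (Or.inl rfl)⟩
    · obtain ⟨U', hag, hsb'⟩ := hproxSite _ hpos hjk _ hy
      exact ⟨U', hsb', hag _ (Or.inr rfl)⟩
  set τ₁ : Fin (constrCard (Bj ν.M₁ Z k) k) → EuclideanSpace ℝ (Fin 3) := fun i => WithLp.toLp 2 fun a => (u i a).re with hτ₁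
  set τ₂ : Fin (constrCard (Bj ν.M₁ Z k) k) → EuclideanSpace ℝ (Fin 3) := fun i => WithLp.toLp 2 fun a => (u i a).im with hτ₂
  have hτ₁0 : ∀ (b : PBond (F.P Kt) 0) (hb : b ∈ bondsOf ((Bj ν.M₁ Z k : DetSet (F.P Kt)) 0)),
      (fun i => φ (τ₁ i)) (constrEnum (Bj ν.M₁ Z k : DetSet (F.P Kt)) k ⟨⟨0, Nat.succ_pos k⟩, b, hb⟩) = 0 := fun b hb => by
    have h0 : τ₁ (constrEnum (Bj ν.M₁ Z k : DetSet (F.P Kt)) k ⟨⟨0, Nat.succ_pos k⟩, b, hb⟩) = 0 := by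
      ext a
      show (u _ a).re = 0
      rw [hu0 b hb]; rfl
    simp only [h0, map_zero]
  have hτ₂0 : ∀ (b : PBond (F.P Kt) 0) (hb : b ∈ bondsOf ((Bj ν.M₁ Z k : DetSet (F.P Kt)) 0)),
      (fun i => φ (τ₂ i)) (constrEnum (Bj ν.M₁ Z k : DetSet (F.P Kt)) k ⟨⟨0, Nat.succ_pos k⟩, b, hb⟩) = 0 := fun b hb => by
    have h0 : τ₂ (constrEnum (Bj ν.M₁ Z k : DetSet (F.P Kt)) k ⟨⟨0, Nat.succ_pos k⟩, b, hb⟩) = 0 := by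
      ext a
      show (u _ a).im = 0
      rw [hu0 b hb]; rfl
    simp only [h0, map_zero]
  obtain ⟨X₁, hX₁S, hX₁im, hX₁l1, hX₁0⟩ := exists_forest_preimage_l1_support_Bj_of_isMinimizer_class ν Kt Z hkK hM4 hdiv hε hsbU hερ hHB hεH hmin hW hroot hF1 hlen
    (fun i => φ (τ₁ i))
  obtain ⟨X₂, hX₂S, hX₂im, -, -⟩ := exists_forest_preimage_l1_support_Bj_of_isMinimizer_class ν Kt Z hkK hM4 hdiv hε hsbU hερ hHB hεH hmin hW hroot hF1 hlen
    (fun i => φ (τ₂ i))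
  obtain ⟨y₁, hy₁S, hy₁n, hy₁z, hv₁⟩ := velocity_of_slicePreimage (Bj ν.M₁ Z k) hk hW hΨ hsharp S hF3 hφ X₁ hX₁S τ₁ hX₁im
  obtain ⟨y₂, hy₂S, -, -, hv₂⟩ := velocity_of_slicePreimage (Bj ν.M₁ Z k) hk hW hΨ hsharp S hF3 hφ X₂ hX₂S τ₂ hX₂im
  have hD₁ : fderiv ℂ Φ₀ 0 ⟨cplxVec y₁, hy₁S⟩ = fun i => WithLp.toLp 2 fun a => ((τ₁ i a : ℝ) : ℂ) :=
    fderiv_sliceDatum_cplxVec_eq_coords_of_velocity (Bj ν.M₁ Z k) k hk W hgU hW S hΦ₀ hy₁S τ₁ hv₁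
  have hD₂ : fderiv ℂ Φ₀ 0 ⟨cplxVec y₂, hy₂S⟩ = fun i => WithLp.toLp 2 fun a => ((τ₂ i a : ℝ) : ℂ) :=
    fderiv_sliceDatum_cplxVec_eq_coords_of_velocity (Bj ν.M₁ Z k) k hk W hgU hW S hΦ₀ hy₂S τ₂ hv₂
  refine ⟨y₁, y₂, hy₁S, hy₂S, ?_, ?_, ?_⟩
  · rw [hD₁, hD₂]
    exact reCoords_add_I_smul_imCoords u
  · intro b hb
    have hb' : b ∈ bondsOf ((Bj ν.M₁ Z k : DetSet (F.P Kt)) 0) := (mem_bondsOf_Bj_zero hk0 Z b).2 (Or.inl hb)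
    exact hy₁z b (hX₁0 b hb' (hτ₁0 b hb'))
  · -- the `ℓ¹` letter: `Σ‖y₁ b‖ = Σ‖↑X₁,b‖_op ≤ C·‖φ ∘ τ₁‖ ≤ C·√2·‖u‖`
    have hsum : ∑ b : PBond (F.P Kt) 0, ‖y₁ b‖ = ∑ b : PBond (F.P Kt) 0, ‖(X₁ b : Matrix (Fin 2) (Fin 2) ℂ)‖ := Finset.sum_congr rfl fun b _ => hy₁n b
    have hτu : ‖(fun i => φ (τ₁ i))‖ ≤ Real.sqrt 2 * ‖u‖ := by
      refine (pi_norm_le_iff_of_nonneg (by positivity)).2 fun i => ?_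
      rw [norm_lieSU2Coord_eq hφ]
      exact mul_le_mul_of_nonneg_left ((norm_reCoords_le (u i)).trans (norm_le_pi_norm u i)) (Real.sqrt_nonneg _)
    have hC : 0 ≤ (1 + 2 * (Fintype.card (PBond (F.P Kt) 0) : ℝ) * Lp) * Real.sqrt (Fintype.card (PBond (F.P Kt) 0)) * B := by positivity
    calc ∑ b : PBond (F.P Kt) 0, ‖y₁ b‖ = ∑ b : PBond (F.P Kt) 0, ‖(X₁ b : Matrix (Fin 2) (Fin 2) ℂ)‖ := hsum
      _ ≤ ((1 + 2 * (Fintype.card (PBond (F.P Kt) 0)) * Lp) * Real.sqrt (Fintype.card (PBond (F.P Kt) 0)) * B) * ‖(fun i => φ (τ₁ i))‖ := hX₁l1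
      _ ≤ ((1 + 2 * (Fintype.card (PBond (F.P Kt) 0)) * Lp) * Real.sqrt (Fintype.card (PBond (F.P Kt) 0)) * B) * (Real.sqrt 2 * ‖u‖) :=
          mul_le_mul_of_nonneg_left hτu hC
      _ = (Real.sqrt 2 * ((1 + 2 * (Fintype.card (PBond (F.P Kt) 0)) * Lp) * Real.sqrt (Fintype.card (PBond (F.P Kt) 0)) * B)) * ‖u‖ := by ring

end Record

/-! ## §4  The multiplier row (M) per base field, modulo (R1b) and (R2) -/

section Multiplier

/-- ★★★ **THE MULTIPLIER ROW (M) FOR EVERY (2.12)-CLASS MINIMISER, MODULO (R1b) AND (R2)** — p710811's `multiplierLetter_of_rightInverseOn` with (R1a) DISCHARGED by §3: per base field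
(minimiser, forest rows + `hlen`, `a` and `Φ₀` by their formulas, the (δ) row), once per height (`hHB`'s ∀-body, `hsbU`, floors, numerics), and the DISPLAYED (R1b) «curvature data of real
kernel directions vanish at the level-0 rows» and (R2) `‖D²Φ₀(0)[p̂,p̂]‖ ≤ M₂·Σ_b‖p b‖²`: `Re ℓ₀(D²Φ₀(0)[p̂,p̂]) ≤ (8(d−1)·δ·B₁·M₂)·Σ_b‖p b‖²`, `B₁ = √2·(1 + 2·#bonds·Lp)·√#bonds·B`.
[cite: Balaban1989LargeFieldII, (1.12)–(1.13) p.359, p.357; Balaban1985Variational, Sect. C (44)–(48) p.285, (82)–(83) p.290; Balaban1988Convergent, (2.2) p.255, (2.10)–(2.13) pp.256–257; Balaban1985BackgroundPropagators, (3.7) p.391] -/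
theorem multiplierLetter_Bj_of_isMinimizer_class (ν : Node00.Stage7Numerics) (Kt : ℕ) (Z : Set (Site (F.P Kt) 0)) (hk0 : 0 < k)
    (hkK : k + 1 ≤ (F.P Kt).m + (F.P Kt).K) (hM4 : 4 * (F.P Kt).L ≤ ν.M₁) (hdiv : side (F.P Kt).L ν.M₁ k ∣ (F.P Kt).sitesPerDir 0) (hε : 0 ≤ ν.εreg)
    {ρ'' : ℝ} (hsbU : ∀ V : GaugeField (F.P Kt) 0 SU2, ‖coeField V - 1‖ ≤ ρ'' → SmallBelow (avOfRecord F 2 Kt) k V)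
    (hερ : 6 * ((((F.P Kt).d - 1 : ℕ)) : ℝ) * (F.P Kt).L * ν.εreg ≤ ρ'')
    {εH B : ℝ}
    (hHB : ∀ (Wd : MSField (F.P Kt) SU2) (U₀ : GaugeField (F.P Kt) 0 SU2),
      AgreeOn (Bj ν.M₁ Z k) (avgFamily (avOfRecord F 2 Kt) U₀) Wd →
      (∀ i' : Fin (constrCard (Bj ν.M₁ Z k) k), ∃ U' : GaugeField (F.P Kt) 0 SU2,
        (∀ b ∈ feeds (((constrEnum (Bj ν.M₁ Z k) k).symm i').1 : ℕ) ((constrEnum (Bj ν.M₁ Z k) k).symm i').2.1, U' b = U₀ b) ∧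
          SmallBelow (avOfRecord F 2 Kt) k U') →
      (∀ (j : ℕ), 1 ≤ j → j ≤ k → ∀ y : Site (F.P Kt) j, embIter j y ∈ maxDomT ν.M₁ Z j → ∃ U' : GaugeField (F.P Kt) 0 SU2,
        (∀ c : PBond (F.P Kt) j, (c.src = y ∨ c.tgt = y) → ∀ b₀ : PBond (F.P Kt) 0,
          (iterBlockOf j b₀.src = c.src ∨ iterBlockOf j b₀.src = c.tgt) → (iterBlockOf j b₀.tgt = c.src ∨ iterBlockOf j b₀.tgt = c.tgt) → U' b₀ = U₀ b₀) ∧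
        SmallBelow (avOfRecord F 2 Kt) k U') →
      (∀ (j : ℕ), 1 ≤ j → j ≤ k → ∀ y : Site (F.P Kt) j, embIter j y ∈ maxDomT ν.M₁ Z j →
        PlaqSmallOn (boxPlaqs (fun κ => lift (F.P Kt) (embIter j y) κ - ((((F.P Kt).L ^ j : ℕ) : ℤ) + ((((F.P Kt).L ^ j - 1) / 2 : ℕ) : ℤ)))
          (fun κ => lift (F.P Kt) (embIter j y) κ + ((((F.P Kt).L ^ j : ℕ) : ℤ) + ((((F.P Kt).L ^ j - 1) / 2 : ℕ) : ℤ))) : Set (Plaq (F.P Kt) 0)) εH U₀) →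
      ∃ H : (Fin (constrCard (Bj ν.M₁ Z k) k) → lieSU (Fin 2)) → PBond (F.P Kt) 0 → lieSU (Fin 2),
        (∀ v, fderiv ℝ (msChart F 2 Kt k (Bj ν.M₁ Z k) Wd U₀) 0 (H v) = v) ∧ ∀ v, Real.sqrt (∑ b, ‖H v b‖ ^ 2) ≤ B * ‖v‖)
    (hεH : ν.εreg ≤ εH) (hB0 : 0 ≤ B)
    -- per base field: the minimiser (class membership), the datum, the forest, the slice action and datum coordinates, the (δ) row
    {𝔹' : DetSet (F.P Kt)} {W' : MSField (F.P Kt) SU2} {U₀ : GaugeField (F.P Kt) 0 SU2}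
    (hmin : IsMinimizer (avOfRecord F 2 Kt) (regMSCoPOfRecord F 2 ν Kt k (maxDomT ν.M₁ Z)) 𝔹' W' U₀)
    {W : MSField (F.P Kt) SU2} (hW : AgreeOn (Bj ν.M₁ Z k) (avgFamily (avOfRecord F 2 Kt) U₀) W)
    (S : Submodule ℂ (VecField (F.P Kt) 0 (EuclideanSpace ℂ (Fin 3)))) {path : Site (F.P Kt) 0 → List (LStep (F.P Kt) 0)}
    (hroot : ∀ r ∈ {z : Site (F.P Kt) 0 | ∃ j, j ≤ k ∧ ∃ c ∈ bondsOf ((Bj ν.M₁ Z k : DetSet (F.P Kt)) j), (z = embIter j c.src ∨ z = embIter j c.tgt)}, path r = [])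
    (hF1 : ∀ x, ∀ s ∈ path x, ∃ x' x'' : Site (F.P Kt) 0, path x'' = path x' ++ [s] ∧
      (s.fwd = true → s.bond.src = x' ∧ s.bond.tgt = x'') ∧ (s.fwd = false → s.bond.src = x'' ∧ s.bond.tgt = x'))
    (hF3 : ∀ Y : VecField (F.P Kt) 0 (EuclideanSpace ℂ (Fin 3)), Y ∈ S ↔ ∀ x, ∀ s ∈ path x, Y s.bond = 0)
    {Lp : ℕ} (hlen : ∀ x, (path x).length ≤ Lp)
    {a : S → ℂ}
    (ha : ∀ X : S, a X = ∑ q : Plaq (F.P Kt) 0, (1 - (expMulC (X : VecField (F.P Kt) 0 (EuclideanSpace ℂ (Fin 3))) (coeField U₀) ⟨q.src, q.μ⟩ *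
      expMulC (X : VecField (F.P Kt) 0 (EuclideanSpace ℂ (Fin 3))) (coeField U₀) ⟨q.src.shift q.μ, q.ν⟩ *
      Matrix.adjugate (expMulC (X : VecField (F.P Kt) 0 (EuclideanSpace ℂ (Fin 3))) (coeField U₀) ⟨q.src.shift q.ν, q.μ⟩) *
      Matrix.adjugate (expMulC (X : VecField (F.P Kt) 0 (EuclideanSpace ℂ (Fin 3))) (coeField U₀) ⟨q.src, q.ν⟩)).trace / 2))
    {Φ₀ : S → Fin (constrCard (Bj ν.M₁ Z k) k) → EuclideanSpace ℂ (Fin 3)}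
    (hΦ₀ : ∀ (X : S) i, Φ₀ X i = logCoordC (star ((W ((constrEnum (Bj ν.M₁ Z k) k).symm i).1 ((constrEnum (Bj ν.M₁ Z k) k).symm i).2.1 : SU2) : Matrix (Fin 2) (Fin 2) ℂ) *
      iterMh ((constrEnum (Bj ν.M₁ Z k) k).symm i).1 (expMulC (X : VecField (F.P Kt) 0 (EuclideanSpace ℂ (Fin 3))) (coeField U₀)) ((constrEnum (Bj ν.M₁ Z k) k).symm i).2.1))
    {δ : ℝ} (hδ0 : 0 ≤ δ)
    (hU : ∀ q : Plaq (F.P Kt) 0, ((⟨q.src, q.μ⟩ : PBond (F.P Kt) 0) ∈ {b : PBond (F.P Kt) 0 | b.src ∈ maxDomT ν.M₁ Z 1} ∨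
          (⟨q.src.shift q.μ, q.ν⟩ : PBond (F.P Kt) 0) ∈ {b : PBond (F.P Kt) 0 | b.src ∈ maxDomT ν.M₁ Z 1} ∨
          (⟨q.src.shift q.ν, q.μ⟩ : PBond (F.P Kt) 0) ∈ {b : PBond (F.P Kt) 0 | b.src ∈ maxDomT ν.M₁ Z 1} ∨
          (⟨q.src, q.ν⟩ : PBond (F.P Kt) 0) ∈ {b : PBond (F.P Kt) 0 | b.src ∈ maxDomT ν.M₁ Z 1}) →
        ‖((U₀ ⟨q.src, q.μ⟩ : SU2) : Matrix (Fin 2) (Fin 2) ℂ) - 1‖ ≤ δ ∧ ‖((U₀ ⟨q.src.shift q.μ, q.ν⟩ : SU2) : Matrix (Fin 2) (Fin 2) ℂ) - 1‖ ≤ δ ∧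
          ‖((U₀ ⟨q.src.shift q.ν, q.μ⟩ : SU2) : Matrix (Fin 2) (Fin 2) ℂ) - 1‖ ≤ δ ∧ ‖((U₀ ⟨q.src, q.ν⟩ : SU2) : Matrix (Fin 2) (Fin 2) ℂ) - 1‖ ≤ δ)
    {M₂ : ℝ}
    -- (R1b) DISPLAYED: the curvature data of real kernel directions vanish at the level-0 rows
    (hAdm : ∀ (p : VecField (F.P Kt) 0 E3) (hp : cplxVec p ∈ S), fderiv ℂ Φ₀ 0 ⟨cplxVec p, hp⟩ = 0 →
      ∀ (b : PBond (F.P Kt) 0) (hb : b ∈ bondsOf ((Bj ν.M₁ Z k : DetSet (F.P Kt)) 0)),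
        fderiv ℂ (fderiv ℂ Φ₀) 0 ⟨cplxVec p, hp⟩ ⟨cplxVec p, hp⟩ (constrEnum (Bj ν.M₁ Z k : DetSet (F.P Kt)) k ⟨⟨0, Nat.succ_pos k⟩, b, hb⟩) = 0)
    -- (R2) DISPLAYED: the chart-curvature letter
    (hcurv : ∀ (p : VecField (F.P Kt) 0 E3) (hp : cplxVec p ∈ S), fderiv ℂ Φ₀ 0 ⟨cplxVec p, hp⟩ = 0 →
      ‖fderiv ℂ (fderiv ℂ Φ₀) 0 ⟨cplxVec p, hp⟩ ⟨cplxVec p, hp⟩‖ ≤ M₂ * ∑ b : PBond (F.P Kt) 0, ‖p b‖ ^ 2) :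
    ∀ ℓ₀ : (Fin (constrCard (Bj ν.M₁ Z k) k) → EuclideanSpace ℂ (Fin 3)) →L[ℂ] ℂ, fderiv ℂ a 0 = ℓ₀.comp (fderiv ℂ Φ₀ 0) →
      ∀ (p : VecField (F.P Kt) 0 E3) (hp : cplxVec p ∈ S), fderiv ℂ Φ₀ 0 ⟨cplxVec p, hp⟩ = 0 →
        (ℓ₀ (fderiv ℂ (fderiv ℂ Φ₀) 0 ⟨cplxVec p, hp⟩ ⟨cplxVec p, hp⟩)).re ≤
          (8 * (((F.P Kt).d : ℝ) - 1) * δ * (Real.sqrt 2 * ((1 + 2 * (Fintype.card (PBond (F.P Kt) 0)) * Lp) * Real.sqrt (Fintype.card (PBond (F.P Kt) 0)) * B)) * M₂) *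
            ∑ b : PBond (F.P Kt) 0, ‖p b‖ ^ 2 :=
  multiplierLetter_of_rightInverseOn S ha Φ₀ {b : PBond (F.P Kt) 0 | b.src ∈ maxDomT ν.M₁ Z 1} hδ0 hU
    (fun u : Fin (constrCard (Bj ν.M₁ Z k) k) → EuclideanSpace ℂ (Fin 3) =>
      ∀ (b : PBond (F.P Kt) 0) (hb : b ∈ bondsOf ((Bj ν.M₁ Z k : DetSet (F.P Kt)) 0)), u (constrEnum (Bj ν.M₁ Z k : DetSet (F.P Kt)) k ⟨⟨0, Nat.succ_pos k⟩, b, hb⟩) = 0)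
    (by positivity)
    (sliceRightInverseOn_levelZeroFree_Bj_of_isMinimizer_class ν Kt Z hk0 hkK hM4 hdiv hε hsbU hερ hHB hεH hB0 hmin hW S hroot hF1 hF3 hlen hΦ₀)
    hAdm hcurv

end Multiplier

end Summit.QuantumFields.YangMills.BalabanUVNodes.N12SlicePreimageLetterOfClass

end
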